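import Summits.QuantumFields.YangMills.Theorems.UnitScaleTiltProp8HalvingDressingLetterFlatScaled
import Summits.QuantumFields.YangMills.Theorems.UnitScaleTiltProp8FlatPortCurlCurlSupRowSharpL0
import HarnessLib

/-!
# Route `UnitScaleTilt`, crux K1 child «MinimiserStabilityRegPr» (stmt-QuantumFields-19200), registered stub V2′ `stub_halvingStep`
# (skeleton v10 `BirthV10`) — **THE DRESSING LETTER `C_E` AT THE `H` OF RECORD `Hs`: (X1) DISCHARGED (♭ KNIT, FILE D♯ v2)** — FILE D♯
# (✓ p614240 `exists_hWq_dressed_cubeSeq_T3_flatHs`, which displayed the level-weighted `∂^{η*}∂^η`-row (X1♯) as a hypothesis) fed with ★w3-19936 g4's landed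
# supplier ✓ p613959 `FlatPortCurlCurlSupRowSharpL0.curlCurlSupRowSharp_of_adm22` (WANTED №g26-1 (X1) under ♭ IN THE TREE): ALL FOUR H-side letters of FILE C
# ((46) `hH`, (X1) `hX1`, (X2-H) `hHcol`, (X2-CH) `hCH`) are now discharged at `H := Hs`; the displayed residue of the C_E node is the chart side alone

Cell `ym3-torus` (HUMAN RULING D-0037, YM ladder rung R3 — continuum SU(2) YM₃ on the torus is a RUNG, not the Clay problem), width seat `ym-ust-19200-w6`
(D-0154 (3c); ★★OWNER ym3-torus-plan g26 RULING g26-№6 (S5)∕(S7), №7 (2), №11 (i)).  `--supports stmt-QuantumFields-19200 --as helper`; count-neutral; def-free,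
0 sorry, standard axioms.

WHAT THIS FILE PROVES (sorry-free; no definition; currency of FILE D♯):
* §1 ★★ `hX1_flatHs_of_adm22` — at every admissible datum of the P2 text and every presentation `HS` with the display of record
  `HS X b = Σ_c ((flatH e_c)(b)·λ_c⁻¹) • X c`: FILE C's `hX1` binder with `B_Δ := C_X(L)` (FILE D♯ §2 ∘ ✓ `curlCurlSupRowSharp_of_adm22`).
* §2 ★★★ **`exists_hWq_dressed_cubeSeq_T3_flatHs_X1`** — FILE C's `exists_hWq_dressed_cubeSeq_T3_of_columnLetters` at the aligned cube sequence (144) with `H := Hs` and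
  ALL FOUR H-side letters discharged (constants `B_H, C_X, K₀, C_P` from `L` alone); displayed residue = (55) `hD`, the chart's regularity rows `h49`∕`hDd`∕`hCd`, the
  (X2-C′) column letter `hCcol` at index weight `u ≥ η⁻³λ⁻¹`, and the numerics `C₃R_cK₀ ≤ ½`, `a₃ ≤ R_c⁰ < R_c`, `(1 + 4B_HC₂R_c⁰)a₃ ≤ 1/(2L)` — the inputs (S3) B3 ✓p613442,
  (S4) ✓p612993 and the (S6) carrier ✓p611306 are built to supply.
HONEST SCOPE.  Plumbing over landed certificates; the chart side is NOT proved here.  NOT a claim about the stub, the crux, the rung or the mass gap; no summit statement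
is proved by this seat.

References: T. Bałaban, CMP **102** (1985) 277–309 [Balaban1985Variational] (44)–(46) p.285, (49) p.285, (55) p.286, (73) p.289, (80)–(89) pp.290–291, (88) p.291, Prop. 4
(97)–(98) pp.292–293, (144) p.300, (157)–(158) p.302, (161)–(163) p.303; CMP **96** (1984) 223–250 [Balaban1984PropagatorsII] (2.1)–(2.4) p.224, Lemma 2.1 (2.61) p.234,
Cor. 2.8 (2.150)–(2.151) p.249.
-/

set_option autoImplicit false

noncomputable section

open scoped BigOperators Matrix Matrix.Norms.L2Operator
open NormedSpace Filter Topology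

namespace Summit.QuantumFields.YangMills.Theorems.HalvingDressingLetter

open Literature.MathematicalPhysics.QuantumFieldTheory.Balaban1983to89
open B6GlobalChartV1 (PV)
open B6SectADomainsV1 (Domains)
open B6SectAOperatorsV1 (BondIdx dcE dcsE)
open T3ContinuumYM3Torus (T3Family)
open FlatCubeOpsText (Adm22 IsLevWeight)
open FlatOpsLettersAssembly (flatH)
open FlatCubeSequenceAligned (cubeSeqMT3 cubeSeqMT3_k)
open FlatCubeSequenceAdm (adm22_cubeSeqMT3)
open FlatPortCurlCurlSupRowSharpL0 (curlCurlSupRowSharp_of_adm22)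

/-- `1 ≤ 3` (named once; every `PV` below carries the same proof term). [folklore] -/
private theorem hd3 : 1 ≤ 2 + 1 := by norm_num

/-! ## §1 (X1) discharged: ★w3-19936 g4's level-weighted row (X1♯) ✓ `FlatPortCurlCurlSupRowSharpL0.curlCurlSupRowSharp_of_adm22` -/

/-- ★★ **(X1)ᴹ AT THE `H` OF RECORD `Hs`, DISCHARGED**: for odd `L = ℓ + 1 ≥ 5` there are `M_h⁰, R₀` and `C_X ≥ 0` (from `L` alone) such that at every admissible datum of the
P2 text and for every presentation `HS` with the display of record `hHS`, FILE C's `hX1` binder holds with `B_Δ := C_X` — FILE D♯ §2's (X1♯) ⟹ (X1)ᴹ clause fed with the landed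
level-weighted `∂^{η*}∂^η`-row of `flatH` (WANTED №g26-1 under ♭, ✓ p613959). [cite: Balaban1985Variational, (45)-(46) p.285, (88) p.291, (157) p.302, (161)-(163) p.303; Balaban1984PropagatorsII, Cor. 2.8 (2.150)-(2.151) p.249, Lemma 2.1 (2.61) p.234] -/
theorem hX1_flatHs_of_adm22 (ℓ : ℕ) (hL : Odd (ℓ + 1) ∧ 1 < ℓ + 1) (hℓ : 4 ≤ ℓ) :
    ∃ (Mh₀ R₀ : ℕ) (CX : ℝ), 0 ≤ CX ∧
    ∀ (m : ℕ) (hm : 1 ≤ m) (n K : ℕ) (_ : 1 ≤ K - n) (_ : K - n + 1 ≤ m + K) {Mh R a' : ℕ} (_ : Mh = (ℓ + 1) ^ a') (_ : Mh₀ ≤ Mh) (_ : R₀ ≤ R)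
      (_ : a' + 3 ≤ m + n) (D : Domains (PV 2 ℓ m K hd3 hL)) (_ : D.k = K - n) (_ : Adm22 D R ((ℓ + 1) * Mh))
      (w : ℕ → PBond (PV 2 ℓ m K hd3 hL) 0 → ℝ) (_ : IsLevWeight (⟨ℓ + 1, hL, m, hm⟩ : T3Family) n K D w)
      (HS : (BondIdx D → Matrix (Fin 2) (Fin 2) ℂ) → PBond (PV 2 ℓ m K hd3 hL) 0 → Matrix (Fin 2) (Fin 2) ℂ)
      (_ : ∀ (X : BondIdx D → Matrix (Fin 2) (Fin 2) ℂ) (b : PBond (PV 2 ℓ m K hd3 hL) 0),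
        HS X b = ∑ c : BondIdx D, (flatH (⟨ℓ + 1, hL, m, hm⟩ : T3Family) n K D (Pi.single c 1) b *
          (((((ℓ + 1 : ℕ) : ℝ)) ^ (c.1.1 : ℕ) * ((((ℓ + 1 : ℕ) : ℝ))⁻¹) ^ (K - n)))⁻¹) • X c),
      ∀ (X : BondIdx D → Matrix (Fin 2) (Fin 2) ℂ) (t : ℝ), 0 ≤ t → (∀ c, ‖X c‖ ≤ t) → ∀ b : PBond (PV 2 ℓ m K hd3 hL) 0,
        w 3 b * ‖((((((((ℓ + 1 : ℕ) : ℝ)⁻¹) ^ (K - n)) : ℝ) : ℂ) ^ 2)⁻¹ • ∑ p : Plaq (PV 2 ℓ m K hd3 hL) 0,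
          ((Pi.single b (1 : ℂ) : PBond (PV 2 ℓ m K hd3 hL) 0 → ℂ) ⟨p.src, p.μ⟩ + (Pi.single b (1 : ℂ) : PBond (PV 2 ℓ m K hd3 hL) 0 → ℂ) ⟨p.src.shift p.μ, p.ν⟩ -
              (Pi.single b (1 : ℂ) : PBond (PV 2 ℓ m K hd3 hL) 0 → ℂ) ⟨p.src.shift p.ν, p.μ⟩ - (Pi.single b (1 : ℂ) : PBond (PV 2 ℓ m K hd3 hL) 0 → ℂ) ⟨p.src, p.ν⟩) •
            (HS X ⟨p.src, p.μ⟩ + HS X ⟨p.src.shift p.μ, p.ν⟩ - HS X ⟨p.src.shift p.ν, p.μ⟩ - HS X ⟨p.src, p.ν⟩))‖ ≤ CX * t := by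
  obtain ⟨Mh₁, R₁, BH, K₀, CP, -, -, -, hmain⟩ := hLetters_flatHs_of_adm22 ℓ hL hℓ
  obtain ⟨Mh₂, R₂, CX, hCX, hsharp⟩ := curlCurlSupRowSharp_of_adm22 ℓ hL hℓ
  refine ⟨max Mh₁ Mh₂, max R₁ R₂, CX, hCX, ?_⟩
  intro m hm n K hk1 hk' Mh R a' hMha hMh hR hsize D hDk hAdm w hw HS hHS
  obtain ⟨-, hX1, -, -⟩ := hmain m hm n K hk1 hk' hMha (le_trans (le_max_left _ _) hMh) (le_trans (le_max_left _ _) hR) hsize D hDk hAdm w hw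
    HS hHS (fun c => ((((ℓ + 1 : ℕ) : ℝ)) ^ (K - n)) ^ 3 * (((((ℓ + 1 : ℕ) : ℝ)) ^ (c.1.1 : ℕ) * ((((ℓ + 1 : ℕ) : ℝ))⁻¹) ^ (K - n)))⁻¹) (fun _ => le_rfl)
  exact hX1 hCX (hsharp m hm n K hk1 hk' hMha (le_trans (le_max_right _ _) hMh) (le_trans (le_max_right _ _) hR) hsize D hDk hAdm w hw)

/-! ## §2 The ♭ knit of record with (X1) discharged: displayed residue = the chart side only -/

/-- ★★★ **THE DRESSING LETTER `C_E` AT THE `H` OF RECORD `Hs`, ALIGNED CUBE SEQUENCE (144), ALL FOUR H-SIDE LETTERS DISCHARGED** — FILE D♯ §3 (`exists_hWq_dressed_cubeSeq_T3_flatHs`) with the (X1♯) binder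
supplied by ✓ `curlCurlSupRowSharp_of_adm22` at the cube sequence (admissible by ✓ `adm22_cubeSeqMT3`): the displayed residue of the C_E node is now EXACTLY the chart
side — (55) `hD`, the regularity rows `h49`∕`hDd`∕`hCd` below `R_c`, the (X2-C′) column letter `hCcol` at index weight `u ≥ η⁻³λ⁻¹`, and the numerics `C₃R_cK₀ ≤ ½`,
`a₃ ≤ R_c⁰ < R_c`, `(1 + 4B_HC₂R_c⁰)a₃ ≤ 1/(2L)` — with `C₄ = C₀θ² + 2C_XC₂ + ½(8C₃(2C_P))θ + 16K₀C₃R_c⁰C₀θ²`, `C₀ = 12L³(1428 + L)`, `θ = 1 + 4B_HC₂R_c⁰`, all of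
`B_H, C_X, K₀, C_P` functions of `L` alone. [cite: Balaban1985Variational, (44)-(46) p.285, (49) p.285, (55) p.286, (73) p.289, (80)-(89) pp.290-291, (88) p.291, Prop. 4 (97)-(98) pp.292-293, (144) p.300, (157)-(158) p.302, (161)-(163) p.303] -/
theorem exists_hWq_dressed_cubeSeq_T3_flatHs_X1 (ℓ : ℕ) (hL : Odd (ℓ + 1) ∧ 1 < ℓ + 1) (hℓ : 4 ≤ ℓ) :
    ∃ (Mh₀ R₀ : ℕ) (BH CX K₀ CP : ℝ), 0 ≤ BH ∧ 0 ≤ CX ∧ 0 ≤ K₀ ∧ 0 ≤ CP ∧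
    ∀ (m : ℕ) (hm : 1 ≤ m) (n K : ℕ) (_ : 1 ≤ K - n) (_ : K - n + 1 ≤ m + K) {Mh R a' : ℕ} (_ : Mh = (ℓ + 1) ^ a') (_ : Mh₀ ≤ Mh) (_ : R₀ ≤ R)
      (_ : a' + 3 ≤ m + n) (x₀ : Site (PV 2 ℓ m K hd3 hL) 0) (ρ S : ℕ) (hM : 1 ≤ (ℓ + 1) * Mh) (_ : R * ((ℓ + 1) * Mh) ≤ S)
      (w : ℕ → PBond (PV 2 ℓ m K hd3 hL) 0 → ℝ)
      (_ : IsLevWeight (⟨ℓ + 1, hL, m, hm⟩ : T3Family) n K (cubeSeqMT3 (⟨ℓ + 1, hL, m, hm⟩ : T3Family) n K x₀ ρ S ((ℓ + 1) * Mh) hM) w)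
      (H : (BondIdx (cubeSeqMT3 (⟨ℓ + 1, hL, m, hm⟩ : T3Family) n K x₀ ρ S ((ℓ + 1) * Mh) hM) → Matrix (Fin 2) (Fin 2) ℂ) →ₗ[ℂ]
        (PBond (PV 2 ℓ m K hd3 hL) 0 → Matrix (Fin 2) (Fin 2) ℂ))
      (_ : ∀ (X : BondIdx (cubeSeqMT3 (⟨ℓ + 1, hL, m, hm⟩ : T3Family) n K x₀ ρ S ((ℓ + 1) * Mh) hM) → Matrix (Fin 2) (Fin 2) ℂ)
        (b : PBond (PV 2 ℓ m K hd3 hL) 0),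
        H X b = ∑ c : BondIdx (cubeSeqMT3 (⟨ℓ + 1, hL, m, hm⟩ : T3Family) n K x₀ ρ S ((ℓ + 1) * Mh) hM),
          (flatH (⟨ℓ + 1, hL, m, hm⟩ : T3Family) n K (cubeSeqMT3 (⟨ℓ + 1, hL, m, hm⟩ : T3Family) n K x₀ ρ S ((ℓ + 1) * Mh) hM) (Pi.single c 1) b *
            ((((ℓ + 1 : ℕ) : ℝ)) ^ (c.1.1 : ℕ) * ((((ℓ + 1 : ℕ) : ℝ))⁻¹) ^ (K - n))⁻¹) • X c)
      (u : BondIdx (cubeSeqMT3 (⟨ℓ + 1, hL, m, hm⟩ : T3Family) n K x₀ ρ S ((ℓ + 1) * Mh) hM) → ℝ)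
      (_ : ∀ c, ((((ℓ + 1 : ℕ) : ℝ)) ^ (K - n)) ^ 3 * ((((ℓ + 1 : ℕ) : ℝ)) ^ (c.1.1 : ℕ) * ((((ℓ + 1 : ℕ) : ℝ))⁻¹) ^ (K - n))⁻¹ ≤ u c)
      (C D : (PBond (PV 2 ℓ m K hd3 hL) 0 → Matrix (Fin 2) (Fin 2) ℂ) →
        (BondIdx (cubeSeqMT3 (⟨ℓ + 1, hL, m, hm⟩ : T3Family) n K x₀ ρ S ((ℓ + 1) * Mh) hM) → Matrix (Fin 2) (Fin 2) ℂ))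
      {C₂ Rc Rc₀ a₃ C₃ : ℝ}
      (_ : ∀ (Y : PBond (PV 2 ℓ m K hd3 hL) 0 → Matrix (Fin 2) (Fin 2) ℂ) (r' : ℝ), r' < Rc → (∀ b, w 1 b * ‖Y b‖ ≤ r') →
        (∀ (b : PBond (PV 2 ℓ m K hd3 hL) 0) (ν : Fin 3), w 2 b * ((ℓ + 1 : ℕ) : ℝ) ^ (K - n) * ‖Y ⟨b.src.shift ν, b.dir⟩ - Y b‖ ≤ r') →
        ∀ c', ‖D Y c'‖ ≤ 4 * C₂ * r' ^ 2)
      (_ : ∀ (Y : PBond (PV 2 ℓ m K hd3 hL) 0 → Matrix (Fin 2) (Fin 2) ℂ) (r : ℝ), r < Rc → (∀ b, w 1 b * ‖Y b‖ ≤ r) →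
        (∀ (b : PBond (PV 2 ℓ m K hd3 hL) 0) (ν : Fin 3), w 2 b * ((ℓ + 1 : ℕ) : ℝ) ^ (K - n) * ‖Y ⟨b.src.shift ν, b.dir⟩ - Y b‖ ≤ r) →
        ∀ᶠ X in 𝓝 Y, D X = C (X - H (D X)))
      (_ : ∀ (Y : PBond (PV 2 ℓ m K hd3 hL) 0 → Matrix (Fin 2) (Fin 2) ℂ) (r : ℝ), r < Rc → (∀ b, w 1 b * ‖Y b‖ ≤ r) →
        (∀ (b : PBond (PV 2 ℓ m K hd3 hL) 0) (ν : Fin 3), w 2 b * ((ℓ + 1 : ℕ) : ℝ) ^ (K - n) * ‖Y ⟨b.src.shift ν, b.dir⟩ - Y b‖ ≤ r) →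
        DifferentiableAt ℂ D Y)
      (_ : ∀ (Y : PBond (PV 2 ℓ m K hd3 hL) 0 → Matrix (Fin 2) (Fin 2) ℂ) (r : ℝ), r < Rc → (∀ b, w 1 b * ‖Y b‖ ≤ r) →
        (∀ (b : PBond (PV 2 ℓ m K hd3 hL) 0) (ν : Fin 3), w 2 b * ((ℓ + 1 : ℕ) : ℝ) ^ (K - n) * ‖Y ⟨b.src.shift ν, b.dir⟩ - Y b‖ ≤ r) →
        DifferentiableAt ℂ C (Y - H (D Y)))
      (_ : ∀ (Y : PBond (PV 2 ℓ m K hd3 hL) 0 → Matrix (Fin 2) (Fin 2) ℂ) (r : ℝ), r < Rc → (∀ b, w 1 b * ‖Y b‖ ≤ r) →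
        (∀ (b : PBond (PV 2 ℓ m K hd3 hL) 0) (ν : Fin 3), w 2 b * ((ℓ + 1 : ℕ) : ℝ) ^ (K - n) * ‖Y ⟨b.src.shift ν, b.dir⟩ - Y b‖ ≤ r) →
        ∀ δ : PBond (PV 2 ℓ m K hd3 hL) 0 → Matrix (Fin 2) (Fin 2) ℂ,
          ∑ c', u c' * ‖fderiv ℂ C (Y - H (D Y)) δ c'‖ ≤ C₃ * r * ∑ b, (w 3 b)⁻¹ * ‖δ b‖)
      (_ : C₃ * Rc * K₀ ≤ 1 / 2) (_ : 0 ≤ C₃) (_ : 0 ≤ C₂) (_ : 0 ≤ Rc₀) (_ : Rc₀ < Rc) (_ : a₃ ≤ Rc₀)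
      (_ : (1 + 4 * BH * C₂ * Rc₀) * a₃ ≤ 1 / (2 * ((ℓ + 1 : ℕ) : ℝ))),
    ∃ W₀ : (PBond (PV 2 ℓ m K hd3 hL) 0 → Matrix (Fin 2) (Fin 2) ℂ) → (PBond (PV 2 ℓ m K hd3 hL) 0 → Matrix (Fin 2) (Fin 2) ℂ),
      (∀ A δ : PBond (PV 2 ℓ m K hd3 hL) 0 → Matrix (Fin 2) (Fin 2) ℂ, fderiv ℂ (fun A : PBond (PV 2 ℓ m K hd3 hL) 0 → Matrix (Fin 2) (Fin 2) ℂ => (∑ p : Plaq (PV 2 ℓ m K hd3 hL) 0, (1 - (2 : ℂ)⁻¹ * Matrix.trace (exp ((Complex.I * ((((((ℓ + 1 : ℕ) : ℝ)⁻¹) ^ (K - n) : ℝ)) : ℂ)) • A ⟨p.src, p.μ⟩) * exp ((Complex.I * ((((((ℓ + 1 : ℕ) : ℝ)⁻¹) ^ (K - n) : ℝ)) : ℂ)) • A ⟨p.src.shift p.μ, p.ν⟩) * exp (-((Complex.I * ((((((ℓ + 1 : ℕ) : ℝ)⁻¹) ^ (K - n) : ℝ)) : ℂ)) • A ⟨p.src.shift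 p.ν, p.μ⟩)) * exp (-((Complex.I * ((((((ℓ + 1 : ℕ) : ℝ)⁻¹) ^ (K - n) : ℝ)) : ℂ)) • A ⟨p.src, p.ν⟩))) + (2 : ℂ)⁻¹ * Matrix.trace (((Complex.I * ((((((ℓ + 1 : ℕ) : ℝ)⁻¹) ^ (K - n) : ℝ)) : ℂ)) • A ⟨p.src, p.μ⟩) + ((Complex.I * ((((((ℓ + 1 : ℕ) : ℝ)⁻¹) ^ (K - n) : ℝ)) : ℂ)) • A ⟨p.src.shift p.μ, p.ν⟩) + (-((Complex.I * ((((((ℓ + 1 : ℕ) : ℝ)⁻¹) ^ (K - n) : ℝ)) : ℂ)) • A ⟨p.src.shift p.ν, p.μ⟩)) + (-((Complex.I * ((((((ℓ + 1 : ℕ) : ℝ)⁻¹) ^ (K - n) : ℝ)) : ℂ)) • A ⟨p.src, p.ν⟩))) + (4 : ℂ)⁻¹ * Matrix.trace ((((Complex.I * ((((((ℓ + 1 : ℕ) : ℝ)⁻¹) ^ (K - n) : ℝ)) : ℂ)) • A ⟨p.src, p.μ⟩) + ((Complex.I * ((((((ℓ + 1 : ℕ) : ℝ)⁻¹) ^ (K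 - n) : ℝ)) : ℂ)) • A ⟨p.src.shift p.μ, p.ν⟩) + (-((Complex.I * ((((((ℓ + 1 : ℕ) : ℝ)⁻¹) ^ (K - n) : ℝ)) : ℂ)) • A ⟨p.src.shift p.ν, p.μ⟩)) + (-((Complex.I * ((((((ℓ + 1 : ℕ) : ℝ)⁻¹) ^ (K - n) : ℝ)) : ℂ)) • A ⟨p.src, p.ν⟩))) ^ 2)))) A δ =
        (((((ℓ + 1 : ℕ) : ℝ)⁻¹) ^ (K - n) : ℝ) : ℂ) ^ 4 * ∑ b : PBond (PV 2 ℓ m K hd3 hL) 0, Matrix.trace (W₀ A b * δ b)) ∧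
      Differentiable ℂ W₀ ∧
      ∀ E : (PBond (PV 2 ℓ m K hd3 hL) 0 → Matrix (Fin 2) (Fin 2) ℂ) → (PBond (PV 2 ℓ m K hd3 hL) 0 → Matrix (Fin 2) (Fin 2) ℂ),
        (∀ (Y : PBond (PV 2 ℓ m K hd3 hL) 0 → Matrix (Fin 2) (Fin 2) ℂ) (b : PBond (PV 2 ℓ m K hd3 hL) 0) (i j : Fin 2), E Y b i j = (((((((ℓ + 1 : ℕ) : ℝ)⁻¹) ^ (K - n)) : ℝ) : ℂ) ^ 4)⁻¹ *
          (-((((((((ℓ + 1 : ℕ) : ℝ)⁻¹) ^ (K - n)) : ℝ) : ℂ) ^ 2 / 2) * ∑ p : Plaq (PV 2 ℓ m K hd3 hL) 0, Matrix.trace ((H (D Y) ⟨p.src, p.μ⟩ + H (D Y) ⟨p.src.shift p.μ, p.ν⟩ - H (D Y) ⟨p.src.shift p.ν, p.μ⟩ - H (D Y) ⟨p.src, p.ν⟩) *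
              (((Pi.single b (Matrix.single j i (1 : ℂ)) : PBond (PV 2 ℓ m K hd3 hL) 0 → Matrix (Fin 2) (Fin 2) ℂ)) ⟨p.src, p.μ⟩ + ((Pi.single b (Matrix.single j i (1 : ℂ)) : PBond (PV 2 ℓ m K hd3 hL) 0 → Matrix (Fin 2) (Fin 2) ℂ)) ⟨p.src.shift p.μ, p.ν⟩ -
                ((Pi.single b (Matrix.single j i (1 : ℂ)) : PBond (PV 2 ℓ m K hd3 hL) 0 → Matrix (Fin 2) (Fin 2) ℂ)) ⟨p.src.shift p.ν, p.μ⟩ - ((Pi.single b (Matrix.single j i (1 : ℂ)) : PBond (PV 2 ℓ m K hd3 hL) 0 → Matrix (Fin 2) (Fin 2) ℂ)) ⟨p.src, p.ν⟩)))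
            - (((((((ℓ + 1 : ℕ) : ℝ)⁻¹) ^ (K - n)) : ℝ) : ℂ) ^ 2 / 2) * ∑ p : Plaq (PV 2 ℓ m K hd3 hL) 0, Matrix.trace (((Y - H (D Y)) ⟨p.src, p.μ⟩ + (Y - H (D Y)) ⟨p.src.shift p.μ, p.ν⟩ - (Y - H (D Y)) ⟨p.src.shift p.ν, p.μ⟩ - (Y - H (D Y)) ⟨p.src, p.ν⟩) *
              (H (fderiv ℂ D Y (Pi.single b (Matrix.single j i (1 : ℂ)))) ⟨p.src, p.μ⟩ + H (fderiv ℂ D Y (Pi.single b (Matrix.single j i (1 : ℂ)))) ⟨p.src.shift p.μ, p.ν⟩ -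
                H (fderiv ℂ D Y (Pi.single b (Matrix.single j i (1 : ℂ)))) ⟨p.src.shift p.ν, p.μ⟩ - H (fderiv ℂ D Y (Pi.single b (Matrix.single j i (1 : ℂ)))) ⟨p.src, p.ν⟩))
            - ((((((ℓ + 1 : ℕ) : ℝ)⁻¹) ^ (K - n)) : ℝ) : ℂ) ^ 4 * ∑ b' : PBond (PV 2 ℓ m K hd3 hL) 0, Matrix.trace (W₀ (Y - H (D Y)) b' * H (fderiv ℂ D Y (Pi.single b (Matrix.single j i (1 : ℂ)))) b'))) →
        ∀ (Y : PBond (PV 2 ℓ m K hd3 hL) 0 → Matrix (Fin 2) (Fin 2) ℂ) (r : ℝ), r < a₃ → (∀ b, w 1 b * ‖Y b‖ ≤ r) →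
          (∀ (b : PBond (PV 2 ℓ m K hd3 hL) 0) (ν : Fin 3), w 2 b * ((ℓ + 1 : ℕ) : ℝ) ^ (K - n) * ‖Y ⟨b.src.shift ν, b.dir⟩ - Y b‖ ≤ r) →
          ∀ b, w 3 b * ‖(W₀ (Y - H (D Y)) + E Y) b‖ ≤
            (12 * (((ℓ + 1 : ℕ) : ℝ) ^ 3 * (1428 + ((ℓ + 1 : ℕ) : ℝ))) * (1 + 4 * BH * C₂ * Rc₀) ^ 2 +
              (2 * CX * C₂ + 2⁻¹ * (8 * C₃ * (2 * CP)) * (1 + 4 * BH * C₂ * Rc₀) +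
                (16 * K₀ * C₃) * Rc₀ * (12 * (((ℓ + 1 : ℕ) : ℝ) ^ 3 * (1428 + ((ℓ + 1 : ℕ) : ℝ)))) * (1 + 4 * BH * C₂ * Rc₀) ^ 2)) * r ^ 2 := by
  obtain ⟨Mh₁, R₁, BH, K₀, CP, hBH, hK₀, hCP, hmain⟩ := exists_hWq_dressed_cubeSeq_T3_flatHs ℓ hL hℓ
  obtain ⟨Mh₂, R₂, CX, hCX, hsharp⟩ := curlCurlSupRowSharp_of_adm22 ℓ hL hℓ
  refine ⟨max Mh₁ Mh₂, max R₁ R₂, BH, CX, K₀, CP, hBH, hCX, hK₀, hCP, ?_⟩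
  intro m hm n K hk1 hk' Mh R a' hMha hMh hR hsize x₀ ρ S hM hRS w hw H hHS u hu C D C₂ Rc Rc₀ a₃ C₃ hD h49 hDd hCd hCcol hsmall hC₃ hC₂ hR₀0 hR₀ ha₃ hθ
  have hAdm : Adm22 (cubeSeqMT3 (⟨ℓ + 1, hL, m, hm⟩ : T3Family) n K x₀ ρ S ((ℓ + 1) * Mh) hM) R ((ℓ + 1) * Mh) :=
    adm22_cubeSeqMT3 (⟨ℓ + 1, hL, m, hm⟩ : T3Family) n K x₀ ρ hM hRS
  have hDk : (cubeSeqMT3 (⟨ℓ + 1, hL, m, hm⟩ : T3Family) n K x₀ ρ S ((ℓ + 1) * Mh) hM).k = K - n :=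
    cubeSeqMT3_k (⟨ℓ + 1, hL, m, hm⟩ : T3Family) n K x₀ ρ S ((ℓ + 1) * Mh) hM
  exact hmain m hm n K hk1 hk' hMha (le_trans (le_max_left _ _) hMh) (le_trans (le_max_left _ _) hR) hsize x₀ ρ S hM hRS w hw H hHS u hu hCX
    (hsharp m hm n K hk1 hk' hMha (le_trans (le_max_right _ _) hMh) (le_trans (le_max_right _ _) hR) hsize
      (cubeSeqMT3 (⟨ℓ + 1, hL, m, hm⟩ : T3Family) n K x₀ ρ S ((ℓ + 1) * Mh) hM) hDk hAdm w hw)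
    C D hD h49 hDd hCd hCcol hsmall hC₃ hC₂ hR₀0 hR₀ ha₃ hθ

end Summit.QuantumFields.YangMills.Theorems.HalvingDressingLetter

end
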